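import Mathlib
import HarnessLib
import HarnessLib.Audit
import Summits.Ventures.CertifiedManyBodySolver.Downfold.BoxesHg1201EKinematicCover
import Summits.Ventures.CertifiedManyBodySolver.Observables.StiffnessApexTransportCurtainTargetSlot

/-!
Route: CovHg1201M19b

DORMANT since 2026-09-03T13:37:07Z (reconciler: no traction for 5 d (last activity item-evidence-added at 2026-08-29T12:54:55Z); parked, not closed — `ledger route dormant route-Ventures-CovHg1201M19b --off` to reactivate) — unstaffed, not closed; items shared with open routes are served there. `ledger route dormant <id> --off` reactivates.

# Route CovHg1201M19b — hubbard-cov-hg1201-1 — certified T = 0 flux-stiffness ceiling below 0.98 ×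
kinematic on the Hg-1201 box M19b, owed on the residual corner patch, from the two «L» bundles of
certified f-sum ceilings

It suffices to show X = PatchLeftEdge ∧ PatchBottom: on the downfolded one-band box of HgBa₂CuO₄₊δ
underdoped p = 0.125 (VSET M19b,
`boxHg1201E_M19b` = U/t ∈ [7/2, 44/5] × t′/t ∈ [−27/50, −43/100] × n ∈ [167/200, 183/200]) the
certified CEILING c = 0.5166800 (= 0.98 × the box
kinematic word 0.5272245, `boxHg1201E_M19b_stiffness_kinematic`) on the thermodynamic-limit
uniform-flux stiffness is OWED ONLY on the RESIDUAL
CORNER PATCH R = t′ ∈ [−27/50, −13/25] × U ∈ [7/2, 44/5] × n ∈ [87/100, 183/200] (the rest is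
node-free kinematics PROVED in the tree,
`Hg1201M19b_StiffnessBoxCeiling_of_cornerPatch`, p607190), and R is discharged lever-free by the
«L»: the LEFT-EDGE bundle (certified ceilings
⟨X₀(σ, U')⟩ ≤ c on torus-limit sector ground states at (−27/50, U', n), U' ∈ [7/2, 44/5]) and the
BOTTOM bundle (the same for ⟨X₀(σ, 7/2)⟩ at
(s, 7/2, n), s ∈ [−27/50, σ]) over target slots σ ∈ [−27/50, −13/25], transported to every point of
R by the target-slot theorem
`ObsStiffnessSeqCeilingAt_on_box_of_bottomEdge_and_leftEdge_targetSlot` (no source outside the box,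
no K₂ input). The pair gives the registered
rung leaf «MOS2-hg1201-M19b» `Hg1201M19b_StiffnessBoxCeiling`.
Lean: `Summit.Ventures.CertifiedManyBodySolver.Theses.CovHg1201M19b.PatchLeftEdge ∧
Summit.Ventures.CertifiedManyBodySolver.Theses.CovHg1201M19b.PatchBottom`

## Assembly
The tree's lever-free target-slot «L» theorem turns the two bundles (values := −c, prices trivial)
into the corner-patch cell leaf
`∀ tp ∈ [−27/50, −13/25], ∀ U ∈ [7/2, 44/5], ∀ n ∈ [87/100, 183/200], ObsStiffnessSeqCeilingAt tp U
n c` with c = 5166800/10⁷, and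
`Hg1201M19b_StiffnessBoxCeiling_of_cornerPatch le_rfl` (box-2 p607190: the complement of R is
node-free kinematics below the bar) concludes the
registered leaf. The deciding theorem is `closes` in glue.lean (elaborates: Sketch.lean v2 `lean
check` rc 0, 0 sorry, 2026-08-28 06:2xZ; the
same proof is `patch_of_bundles` + `closes` there).

CLOSES_TARGET: closes rung MO-S2 of Ventures/CertifiedManyBodySolver: Summit.Ventures.CertifiedManyBodySolver.Observables.Hg1201M19b_StiffnessBoxCeiling (D-0061; not the summit Statement) — the deciding theorem of this route concludes that registered leaf (Ventures/CertifiedManyBodySolver: no summit Statement) (class rung: servable and labelled, never counted as concluding the summit Statement).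

Rationale: WHY THIS LINE. The mechanism is the f-sum (odd-moment) CEILING on the flux stiffness (Kohn1964;
ScalapinoWhiteZhang1993 §II; Lipparini2008 eq. (8.30);
HazraVermaRanderia2019 eqs. (2)–(6)): ρ_s ≤ ⟨X₀(t′, U)⟩, the kinetic combination, whose
thermodynamic-limit ground-state expectation at a TARGET
(t′, U) is bounded through the Hellmann–Feynman orbit by certified expectations of the target-slot
objective −X₀(σ, ·) at SOURCE points on the
left edge (t′ = −27/50) and the bottom (U = 7/2) of the patch
(`ObsStiffnessSeqCeilingAt_on_box_of_bottomEdge_and_leftEdge_targetSlot`, in tree: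
U-monotonicity of the f-sum objective along the orbit, the curtain/target-slot edition, lever-free),
each source certified by exact rational SDP
dual rows on torus-limit RDM relaxations (`SquareTTPrimeCorrOrbitLowerRow` claim nodes) and read
over the density interval by WN filling rows.
Imported from many-body sum-rule theory and convex optimisation (arXiv:2310.05844); nothing
probabilistic. What it does that prior routes do not:
the first typed material-box obligation beyond La₂CuO₄ on a DOPED box whose binding corner (U/t,
t′/t, n) = (7/2, −0.54, 0.915) is weak-coupling and
strongly frustrated; after the kinematic cover the route's entire content is whether the own-slot
corner word w(7/2) and its «L» neighbours clear a
bar sitting 0.42 % under exact one-body kinematics and 16 % above the free value (captain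
HG1201-COVERAGE-PLAN §3, decision node D1).

RANKED CRUXES. #2 PatchLeftEdge (crux) — «PatchLeftEdge» = the LEFT-EDGE BUNDLE of R: for every
density n ∈ [87/100, 183/200], slot σ ∈ [−27/50, −13/25] and station U' ∈ [7/2, 44/5], every
torus-limit sector ground state at the Hamiltonian point (t′, U, n) = (−27/50, U', n) has
D₄-averaged expectation of the target-slot f-sum objective −X₀(σ, U') at least −0.5166800, i.e. the
certified ceiling ⟨X₀(σ, U')⟩ ≤ 0.98 × the box kinematic word (own-slot corner words w(U') = the
case σ = −27/50; intended witness: own-slot reads at vertices U' ∈ {7/2, 5, 44/5} + the U-segment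
device (eom rows affine in U, floor = chord of vertex floors, cap = upper vertex's cap), reader
owner hubbard-cov-hg1201-box-1; BC3 skeleton `bc/PatchLeftEdge_birth.lean`). [difficulty: L] (why it
might fail: WINDOW-LIMITED FIRST ORDER: the own-slot word at the corner (7/2, −27/50, 0.915) needs a
one-body budget W* ≈ 0.19 t while today's certified windows there are W ≈ 0.22 (HF cap) to 0.45; the
bar is 0.42 % under exact kinematics (decision node D1 (ii)/(iii)).) [HazraVermaRanderia2019,
ScalapinoWhiteZhang1993, arXiv:2205.12325, arXiv:2310.05844, KomaTasaki1994]
#3 PatchBottom (crux) — «PatchBottom» = the BOTTOM BUNDLE of R: for every n ∈ [87/100, 183/200],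
slot σ ∈ [−27/50, −13/25] and source s ∈ [−27/50, σ], every torus-limit sector ground state at (s,
7/2, n) has D₄-averaged expectation of −X₀(σ, 7/2) at least −0.5166800 (σ-span 1/50; vertices = the
corner parent shared with PatchLeftEdge + ONE parent at (7/2, −13/25, n), two END-objective reads
per vertex and the σ-chord; BC3 skeleton `bc/PatchBottom_birth.lean`). [difficulty: M] (why it might
fail: only through its s = −27/50 end, which IS PatchLeftEdge's corner word w(7/2) (same window
budget W* ≈ 0.19 t); at s → −13/25 the free value is ≥ 2 % under the bar, so an independent failure
needs a window slack above ≈ 0.01 t there.) [HazraVermaRanderia2019, arXiv:2310.05844,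
KomaTasaki1994]

TWO-LAYER PLAN. Foreseen glued splits (nothing filed now): PatchLeftEdge ⇐ LeftEdgeLowU (U' ∈ [7/2,
5]) → LeftEdgeHighU (U' ∈ [5, 44/5]) → PatchLeftEdge
(glue = interval union; only if the U-segment device needs a station split, captain §6) — each child
worded by own-slot vertex reads + the U-segment
device, or by the apex LADDER along the edge with short corner-objective overhangs (captain §3.2 E4,
insurance); PatchBottom ⇐ its two vertex
END-objective families + σ-chord (`…_of_patchStation7o2_twoEndObjectives` shape). The density
interval [87/100, 183/200] is read from WN filling rows
of the n = 183/200 parents (filling-multiplier slope printed in-job); if the slope sign does not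
close the segment, second density-vertex parents at
n = 87/100 (captain §3.2 S3). INSURANCE editions already in tree stay citable: box-2's one-station
overhang closers
`Hg1201M19b_StiffnessBoxCeiling_of_patchStation7o2_cornerObjective` / slab bodies (far sources
−0.702 / −0.773; not producible on today's caps).

KILL CRITERIA. ROUTE-KILL witness (referee wording, ADOPTED (ooo4)): a certified torus-limit
ground-state FLOOR on ⟨X₀(−27/50, U')⟩ (or on a target-slot
objective of the «L») ABOVE 0.5166800 at a point of R — then no f-sum / orbit-lower edition can
close there and the line as drawn is dead (pivot =
a director bar, a TIER-2 content rung keyed to 0.98 × V per corner typed BESIDE the leaf, or a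
U-floor revision of the box by the unc seats) — NOT
expected (truth at the corner ≈ 0.44 [EST ≤ V = 0.4447]). ITEM REFUTATION of PatchLeftEdge /
PatchBottom as typed = such a floor on the f-sum
objective's expectation (a certified kinetic-energy-combination LOWER bound at a doped frustrated
point — no instrument of record produces one at
the needed precision); a flux-STIFFNESS floor above the bar would refute the leaf itself and is not
producible at all
(StiffnessFloorInvisibleToSpectralMoments). The REALISTIC failure is INSTRUMENTAL = decision node D1
(iii)/(ii-c): the corner certificate lands
above the bar ⇒ the leaf stays OPEN, c is banked as a CONTROL number with its companion ratios c/F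
(F = V = 0.44468 at the corner) and c/K
(K = 0.51885), nothing moves. A proved PatchBottom with PatchLeftEdge open moots nothing: it is
banked as the bottom-bundle word.

NOT DECOMPOSED YET. The vertex parents (EXT5-L⁺ / GENONLY at (−27/50, U' ∈ {7/2, 5, 44/5}, 183/200)
and (−13/25, 7/2, 183/200)), the caps (box-1 HF caps by
`decide +kernel`, p607448 / p607886; a correlated cap is the single most valuable external input),
the U-segment device or ladder, the WN density
reading, and the exact rational certificate format are layer-2 / producer business (seats
`hubbard-cov-hg1201-gen-1`, `-box-1…2`, `-sdp-1…2`,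
referee `-ref-1`, captain `-plan-1` HG1201-COVERAGE-PLAN v0.1 5bad2b3b73a610f2); the patch R and the
«L» edition are the captain's (re-cut = re-split,
not a new route). The M19 twin (bar 0.5084577, `Hg1201M19_StiffnessBoxCeiling_of_cornerPatch`) is
ranked AFTER M19b and is not in this route.

CHEAPEST FALSIFIER. w(7/2) = the exact −v of the own-slot corner leg at (−27/50, 7/2, 183/200)
(hubbard-cov-hg1201-sdp-2 corner parents FIRED 05:56Z 08-28,
pre-registered; calibration legs «CAL-HG-A» ×4 / «CAL-HG-B» ×2 by -sdp-1 print first): decision node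
D1 — (i) −v ≤ 0.5166800 ⇒ proceed; (ii)
0.5166800 < −v < 0.5188 ⇒ one escalation round (cap swap, then parent upgrade at the one corner
point); (iii) −v ≥ 0.5183 ⇒ the corner is out of
reach of window-SDP on today's caps, the leaf stays OPEN and R is reported BY VALUE. The U = 0
sanity (free ⟨X₀⟩ at every «L» source below the
bar: corner F = 0.4447, bathtub K = 0.5188) is done [float, captain §2 / ndnio2-sdp-2 scout].

NUMBERS. Box kinematic words (tree, `Downfold/BoxesCuprateEStiffnessKinematic.lean`): M19b
0.5272245, M19 0.5188344; bars 0.98 × = 0.5166800 / 0.5084577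
(D-0150 content-bar convention); residual patch R = [−27/50, −13/25] × [7/2, 44/5] × [87/100,
183/200] (kinematic cover constants of p607190 below the
bar elsewhere; n-refined bathtub reading: content only at n ≳ 0.905, t′ → −27/50 [float]); binding
corner: exact one-body K = 0.51885 (bar 0.42 %
under it), free V = 0.44468 (bar 16 % above it) — interim clause: content = below 0.98 × the
kinematic MAJORANT word; no suppression-below-free is
claimed; window budget W* ≈ 0.19 t own slot vs W ≈ 0.22–0.45 today [captain §2, referee replay 6/6];
La214 template numbers: kinematic 0.4453763,
bar 0.4364687, CTL 99 ρ_s(6, 1, −3/10) ≤ 0.3798685 (12.4 % below free; the method's BC5 rung outside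
any kinematic regime).

DEFINITION REQUESTS. None: every notion is in tree (`ObsStiffnessSeqCeilingAt`,
`StiffnessBoxCeilingBelow`, `boxHg1201E_M19b`, `InfVolFermionState`,
`IsGroundStateInSector`, `hubbardTorusTT'`, `oddMomentObsTT`, the target-slot «L» theorem and the
corner-patch closer).

Novelty: Searches (2026-08-28): `lit search --hybrid "upper bound superfluid stiffness kinetic energy f-sum
rule Hubbard model" -n 6` (6 docs: [corpus:book:lipparini2008 pp. 464–465], [corpus:book:griffin1995
p. 470], [corpus:book:lieb2005 p. 169]); `lit galaxy search "superfluid stiffness bound|upper bound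
on the superfluid" --star pdf -n 6` (3 hits: [galaxy:pdf:5090094321543315700] Leggett's bound for
amorphous solids; [galaxy:pdf:4957438413378348860] Saslow–Galli–Reatto cond-mat/0612464); tree:
`ledger route closers --problem Ventures` (no material-box leaf before p602446), `rg
StiffnessBoxCeiling` (p602446 only).
Nearest prior art found: HazraVermaRanderia2019 (PRX 9, 031049: D_s ≤ kinetic bound, float
numerics), Leggett's variational upper bound [galaxy:pdf:5090094321543315700], the programme's own
La214 obligation `Downfold/BoxesLa214V115M2b` and stiffness rows (arXiv:2310.05844 for the SDP
side).
Delta: the same sum-rule ceiling made CERTIFIED (exact rational duals) and transported lever-free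
over the residual corner patch of a doped material box by the target-slot «L» theorem; a
registration (crew rung route) on a second material, not a mechanism.
Claimed grade: known  [refs: 2310.05844, book:lipparini2008, book:griffin1995, book:lieb2005, HazraVermaRanderia2019]

Barriers (technique_class: sdp-lower-bound, sum-rule-moment-ceiling, box-transport): - technique_class: sdp-lower-bound, sum-rule-moment-ceiling, box-transport
- Literature.Barriers.HubbardSuperconductivity.StiffnessFloorInvisibleToSpectralMoments: conceded
and irrelevant — the route claims CEILINGS only, which is exactly what finitely many moments give.
- Literature.Barriers.HubbardSuperconductivity.EnergyWindowCeilingResolution: inside its class and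
load-bearing — the ceiling resolves only down to the window slack; the bet is that the own-slot /
target-slot windows at the «L» sources (corner (7/2, −27/50, 0.915) first) reach the one-body budget
W* ≈ 0.19 t through tighter caps and the relaxation's kinetic–docc coupling that «CAL-HG-A/B»
measure — it does not evade the barrier by construction, the bet is the measured coupling;
PatchLeftEdge's why-might-fail is this barrier priced (decision node D1).
- Literature.Barriers.HubbardSuperconductivity.DegreeFourSosMissesSecondOrderPerturbation: inside
its class at the corner U/t = 7/2 — but after the kinematic cover NO suppression below the free
value needs certifying (bar 16 % above free at the corner); it bites only through the absolute
window width, i.e. through EnergyWindowCeilingResolution.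
- Literature.Barriers.HubbardSuperconductivity.SignProblemNPHard: outside its class — exact rational
dual certificates, nothing sampled.
- Literature.Barriers.HubbardSuperconductivity.OrderParameterInvisibleToGroundStateConstraints:
conceded, irrelevant (no order-parameter floor claimed).
- Ladder ceiling (BC9): method_fam

History (route lifecycle, newest last):
- 2026-09-03T13:37:07Z · DORMANT — reconciler: no traction for 5 d (last activity item-evidence-added at 2026-08-29T12:54:55Z); parked, not closed — `ledger route dormant route-Ventures-CovHg1201 (operator:999:3327338)

sub-problem: CertifiedManyBodySolver · status: dormant · opened planner-hubbard-obs-lead-g18-0 2026-08-28T06:25:13Z · rev 0 · ledger route-Ventures-CovHg1201M19b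
GENERATED by the gate from the ledger (D-0016/17). Provers cite these decls: `theorem foo : Summit.Ventures.CertifiedManyBodySolver.Theses.CovHg1201M19b.<Decl> := …` in Summits/Ventures/CertifiedManyBodySolver/Theorems/<Name>.lean.
-/

namespace Summit.Ventures.CertifiedManyBodySolver.Theses.CovHg1201M19b

open scoped BigOperators Topology Manifold Classical MeasureTheory ProbabilityTheory Matrix InnerProductSpace ComplexConjugate ContinuousMap
open Filter Set Function TopologicalSpace MeasureTheory

-- H21.Audit: Ventures rung route — no summit Statement decl; the expected conclusion is the closer leaf tagged below
attribute [summit_statement] _root_.Summit.Ventures.CertifiedManyBodySolver.Observables.Hg1201M19b_StiffnessBoxCeiling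

/-- item stmt-Ventures-26186 · crux · rank 2 · open · by planner
why it might fail: WINDOW-LIMITED FIRST ORDER: the own-slot word at the corner (7/2, −27/50, 0.915) needs a one-body budget W* ≈ 0.19 t while today's certified windows there are W ≈ 0.22 (HF cap) to 0.45; the bar is 0.42 % under exact kinematics (decision node D1 (ii)/(iii)).
sources: HazraVermaRanderia2019, ScalapinoWhiteZhang1993, arXiv:2205.12325, arXiv:2310.05844, KomaTasaki1994
[crux] «PatchLeftEdge» = the LEFT-EDGE BUNDLE of R: for every density n ∈ [87/100, 183/200], slot σ
∈ [−27/50, −13/25] and station U' ∈ [7/2, 44/5], every torus-limit sector ground state at the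
Hamiltonian point (t′, U, n) = (−27/50, U', n) has D₄-averaged expectation of the target-slot f-sum
objective −X₀(σ, U') at least −0.5166800, i.e. the certified ceiling ⟨X₀(σ, U')⟩ ≤ 0.98 × the box
kinematic word (own-slot corner words w(U') = the case σ = −27/50; intended witness: own-slot reads
at vertices U' ∈ {7/2, 5, 44/5} + the U-segment device (eom rows affine in U, floor = chord of
vertex floors, cap = upper vertex's cap), reader owner hubbard-cov-hg1201-box-1; BC3 skeleton
`bc/PatchLeftEdge_birth.lean`). [difficulty: L] -/
@[route_item "route-Ventures-CovHg1201M19b"]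
def PatchLeftEdge : Prop :=
  ∀ n ∈ Set.Icc (87 / 100 : ℝ) (183 / 200), ∀ σ ∈ Set.Icc (-27 / 50 : ℝ) (-13 / 25), ∀ U' ∈ Set.Icc (7 / 2 : ℝ) (44 / 5), ∀ (ω : Literature.MathematicalPhysics.QuantumLattice.InfVolFermionState 2) (Ls : ℕ → ℕ) (ψ : ∀ L, Literature.MathematicalPhysics.QuantumLattice.Fock (Literature.MathematicalPhysics.QuantumLattice.Orb (Literature.MathematicalPhysics.QuantumLattice.FermionTorus 2 L))), Filter.Tendsto Ls Filter.atTop Filter.atTop → (∀ j, Literature.MathematicalPhysics.QuantumLattice.IsGroundStateInSector (Literature.MathematicalPhysics.QuantumLattice.hubbardTorusTT' (Ls j) 1 (-27 / 50) U') (Literature.MathematicalPhysics.QuantumLattice.ThermodynamicLimit.rectN n (Ls j)) 0 (ψ (Ls j))) → (∀ j, star (ψ (Ls j)) ⬝ᵥ ψ (Ls j) = 1) → ω.IsTorusLimitOf ψ Ls → -(5166800 / 10000000 : ℝ) ≤ ((Finset.univ : Finset (DihedralGroup 4)).card : ℝ)⁻¹ * ∑ g ∈ (Finset.univ : Finset (DihedralGroup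 4)), (ω.expect (Literature.MathematicalPhysics.QuantumLattice.d4ShiftSet g 0 (Literature.Probability.LatticeModels.box 2 7)) (Literature.MathematicalPhysics.QuantumLattice.fermionEmbed (Literature.MathematicalPhysics.QuantumLattice.PolySite.d4Emb g 0 (Literature.Probability.LatticeModels.box 2 7)) (-Summit.Ventures.CertifiedManyBodySolver.Observables.oddMomentObsTT σ U' 0))).re

/-- item stmt-Ventures-26187 · crux · rank 3 · open · by planner
why it might fail: only through its s = −27/50 end, which IS PatchLeftEdge's corner word w(7/2) (same window budget W* ≈ 0.19 t); at s → −13/25 the free value is ≥ 2 % under the bar, so an independent failure needs a window slack above ≈ 0.01 t there.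
sources: HazraVermaRanderia2019, arXiv:2310.05844, KomaTasaki1994
[crux] «PatchBottom» = the BOTTOM BUNDLE of R: for every n ∈ [87/100, 183/200], slot σ ∈ [−27/50,
−13/25] and source s ∈ [−27/50, σ], every torus-limit sector ground state at (s, 7/2, n) has
D₄-averaged expectation of −X₀(σ, 7/2) at least −0.5166800 (σ-span 1/50; vertices = the corner
parent shared with PatchLeftEdge + ONE parent at (7/2, −13/25, n), two END-objective reads per
vertex and the σ-chord; BC3 skeleton `bc/PatchBottom_birth.lean`). [difficulty: M] -/
@[route_item "route-Ventures-CovHg1201M19b"]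
def PatchBottom : Prop :=
  ∀ n ∈ Set.Icc (87 / 100 : ℝ) (183 / 200), ∀ σ ∈ Set.Icc (-27 / 50 : ℝ) (-13 / 25), ∀ s ∈ Set.Icc (-27 / 50 : ℝ) σ, ∀ (ω : Literature.MathematicalPhysics.QuantumLattice.InfVolFermionState 2) (Ls : ℕ → ℕ) (ψ : ∀ L, Literature.MathematicalPhysics.QuantumLattice.Fock (Literature.MathematicalPhysics.QuantumLattice.Orb (Literature.MathematicalPhysics.QuantumLattice.FermionTorus 2 L))), Filter.Tendsto Ls Filter.atTop Filter.atTop → (∀ j, Literature.MathematicalPhysics.QuantumLattice.IsGroundStateInSector (Literature.MathematicalPhysics.QuantumLattice.hubbardTorusTT' (Ls j) 1 s (7 / 2)) (Literature.MathematicalPhysics.QuantumLattice.ThermodynamicLimit.rectN n (Ls j)) 0 (ψ (Ls j))) → (∀ j, star (ψ (Ls j)) ⬝ᵥ ψ (Ls j) = 1) → ω.IsTorusLimitOf ψ Ls → -(5166800 / 10000000 : ℝ) ≤ ((Finset.univ : Finset (DihedralGroup 4)).card : ℝ)⁻¹ * ∑ g ∈ (Finset.univ : Finset (DihedralGroup 4)),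 (ω.expect (Literature.MathematicalPhysics.QuantumLattice.d4ShiftSet g 0 (Literature.Probability.LatticeModels.box 2 7)) (Literature.MathematicalPhysics.QuantumLattice.fermionEmbed (Literature.MathematicalPhysics.QuantumLattice.PolySite.d4Emb g 0 (Literature.Probability.LatticeModels.box 2 7)) (-Summit.Ventures.CertifiedManyBodySolver.Observables.oddMomentObsTT σ (7 / 2) 0))).re

/-- item stmt-Ventures-26188 · assembly · rank 1 · closed · proved by Summit.Ventures.CertifiedManyBodySolver.Theorems.covHg1201M19bAssembly_proof (prover) · by planner
sources: ScalapinoWhiteZhang1993, KomaTasaki1994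
[assembly] PatchLeftEdge → PatchBottom → the rung leaf Hg1201M19b_StiffnessBoxCeiling -/
@[route_item "route-Ventures-CovHg1201M19b"]
def Assembly : Prop :=
  Summit.Ventures.CertifiedManyBodySolver.Theses.CovHg1201M19b.PatchLeftEdge → Summit.Ventures.CertifiedManyBodySolver.Theses.CovHg1201M19b.PatchBottom → Summit.Ventures.CertifiedManyBodySolver.Observables.Hg1201M19b_StiffnessBoxCeiling

-- `Assembly` holds: proved by `Summit.Ventures.CertifiedManyBodySolver.Theorems.covHg1201M19bAssembly_proof` (its module imports this route file, so no `_holds` link can be stated here).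

/-! D-0027 §2.1 — DECIDING THEOREM (planner-authored via `route open/edit --closes-file`; by planner-hubbard-obs-lead-g18-0 2026-08-28T06:25:13Z):
its hypotheses are this route's items and its conclusion the registered leaf `Summit.Ventures.CertifiedManyBodySolver.Observables.Hg1201M19b_StiffnessBoxCeiling` (rung MO-S2, D-0061) (glue_lint), and it elaborates with this file. -/

@[closes "route-Ventures-CovHg1201M19b"] theorem closes (h₁ : PatchLeftEdge) (h₂ : PatchBottom) :
    Summit.Ventures.CertifiedManyBodySolver.Observables.Hg1201M19b_StiffnessBoxCeiling :=
  Summit.Ventures.CertifiedManyBodySolver.Downfold.Hg1201M19b_StiffnessBoxCeiling_of_cornerPatch le_rfl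
    fun tp htp U hU n hn =>
      Summit.Ventures.CertifiedManyBodySolver.Observables.ObsStiffnessSeqCeilingAt_on_box_of_bottomEdge_and_leftEdge_targetSlot
        (p := -27 / 50) (q := -13 / 25) (UA := 7 / 2) (Umax := 44 / 5) (n := n)
        (by norm_num) (by norm_num) (by norm_num) (by linarith [hn.1]) (by linarith [hn.2])
        (fun _ _ => -(5166800 / 10000000 : ℝ)) (fun _ _ => -(5166800 / 10000000 : ℝ)) (5166800 / 10000000)
        (fun σ hσ s hs => h₂ n hn σ hσ s hs) (fun σ _ s _ => by norm_num) (fun σ hσ U' hU' => h₁ n hn σ hσ U' hU')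
        (fun σ _ U' _ => by norm_num) tp htp U hU

end Summit.Ventures.CertifiedManyBodySolver.Theses.CovHg1201M19b
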